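import Mathlib
import Summits.ValiantsHypothesis.ValiantsHypothesis.Theorems.NewtonUnitEquationsNewtonTauWeakThreeCoreExposed

/-!
# `NewtonUnitEquationsNewtonTauWeakTwoCorePerfect` — two cores are hereditarily perfect

Line `binomial-normal-form` of crux `NewtonTauWeak` (stmt-ValiantsHypothesis-5904), lead c7, stub P15
(`stub_twoCorePerfect`, the registered text verbatim).  A two-core DESIGN is `h : Fin 2 → Finset (Fin x) → ℕ²`
(costs written `Fin 2 →₀ ℕ`); a configuration `f : Fin x → Fin 2`, read through a window `V ⊆ Fin x`, has the point
`P_V f = h 0 (V ∩ f⁻¹ 0) + h 1 (V ∩ f⁻¹ 1)`, and the LOWER-HULL VERTICES of the cloud `C_V = {P_V f}` are the strict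
maximisers over `C_V` of a height `t·q₀ − q₁`, `t ∈ ℝ`.  The landed P12 (`stub_twoCoreChartRel`) bounds their number
by `2^{|V|}`; this file shows the bound is attained by ONE design for EVERY window `V` simultaneously (the tightness
of the level `k = 1` of `coreChart_logBound`).

## The construction (the "parabola design")

With the base-`3` weight `B S = Σ_{u ∈ S} 3^u` put `h 1 S = (B S, (B S)²)` and `h 0 S = 0`.  Then
`P_V f = (B S, (B S)²)` for `S = V ∩ f⁻¹ 1`, and every `S ⊆ V` arises (from the indicator colouring of `S`), so the
cloud `C_V` is the set of parabola points `(B S, (B S)²)`, `S ⊆ V`.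

* `B` is injective on `Finset (Fin x)` (base-`3` expansions with digits `0/1`; we reuse
  `ThreeCoreExposedAux.digitSum_injective` on indicator digit functions), so `C_V` has exactly `2^{|V|}` points.
* Every parabola point `(b, b²)` is the strict maximiser of the height `2b·q₀ − q₁` over the parabola: for
  `b' ≠ b`, `2b·b' − b'² < 2b·b − b²` is `0 < (b − b')²` (the chord lies below the tangent).

Hence all `2^{|V|}` cloud points are lower-hull vertices.  Main result: `stub_twoCorePerfect` (registered
signature).  Helpers in the sub-namespace `TwoCorePerfectAux`, stated for an arbitrary injective weight
`B : Finset (Fin x) → ℕ`; Mathlib plus the sibling's digit-sum injectivity; everything is [folklore].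
-/

-- Sub = Summit single-conjunct layout: the duplicated namespace component is mandated by the tree.
set_option linter.dupNamespace false

open scoped BigOperators

namespace Summit.ValiantsHypothesis.ValiantsHypothesis.Theorems.NewtonUnitEquationsNewtonTauWeak

namespace TwoCorePerfectAux

open Finset

/-! ## §1 The base-`3` weight of a finite set is injective -/

/-- The base-`3` weight `Σ_{u ∈ S} 3^u` of `S` is the digit sum of the indicator digit function of `S`.
[folklore] -/
theorem weight_eq_digitSum {x : ℕ} (S : Finset (Fin x)) :
    ∑ u ∈ S, 3 ^ (u : ℕ) = ∑ u, ((if u ∈ S then (1 : Fin 3) else 0 : Fin 3) : ℕ) * 3 ^ (u : ℕ) :=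
  calc ∑ u ∈ S, 3 ^ (u : ℕ) = ∑ u, if u ∈ S then 3 ^ (u : ℕ) else 0 := (Fintype.sum_ite_mem S _).symm
    _ = ∑ u, ((if u ∈ S then (1 : Fin 3) else 0 : Fin 3) : ℕ) * 3 ^ (u : ℕ) :=
        Finset.sum_congr rfl fun u _ => by split_ifs <;> simp

/-- WEIGHTS ARE INJECTIVE: `S ↦ Σ_{u ∈ S} 3^u` is injective on `Finset (Fin x)` (uniqueness of base-`3`
expansions, through `ThreeCoreExposedAux.digitSum_injective` applied to indicator digit functions). [folklore] -/
theorem weight_injective (x : ℕ) :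
    Function.Injective fun S : Finset (Fin x) => ∑ u ∈ S, 3 ^ (u : ℕ) := by
  intro S S' hSS'
  have hf := ThreeCoreExposedAux.digitSum_injective x (fun u => if u ∈ S then 1 else 0)
    (fun u => if u ∈ S' then 1 else 0)
    (by rw [← weight_eq_digitSum, ← weight_eq_digitSum]; exact hSS')
  ext u
  have hu := congrFun hf u
  constructor
  · intro h1
    by_contra h2
    rw [if_pos h1, if_neg h2] at hu
    exact absurd hu (by decide)
  · intro h2
    by_contra h1
    rw [if_neg h1, if_pos h2] at hu
    exact absurd hu (by decide)

/-! ## §2 The parabola: the chord lies below the tangent -/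

/-- STRICT EXPOSURE ON THE PARABOLA: for naturals `b' ≠ b`, `2b·b' − b'² < 2b·b − b²`, i.e. the parabola point
`(b, b²)` is the strict maximiser of the height `2b·q₀ − q₁` among the parabola points `(b', b'²)`. [folklore] -/
theorem tangent_exposed (b b' : ℕ) (h : b' ≠ b) :
    2 * (b : ℝ) * (b' : ℝ) + (-1) * ((b' ^ 2 : ℕ) : ℝ) < 2 * (b : ℝ) * (b : ℝ) + (-1) * ((b ^ 2 : ℕ) : ℝ) := by
  have hb : (b' : ℝ) ≠ b := by exact_mod_cast h
  push_cast
  nlinarith [mul_self_pos.mpr (sub_ne_zero.mpr hb)]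

/-- The two coordinates of the planar point `single 0 a + single 1 c`. [folklore] -/
theorem point_apply (a c : ℕ) :
    (Finsupp.single (0 : Fin 2) a + Finsupp.single 1 c : Fin 2 →₀ ℕ) 0 = a ∧
      (Finsupp.single (0 : Fin 2) a + Finsupp.single 1 c : Fin 2 →₀ ℕ) 1 = c := by
  constructor <;> simp

/-! ## §3 The parabola design for an arbitrary weight `B` -/

section Design

variable {x : ℕ} (B : Finset (Fin x) → ℕ)

/-- THE POINT OF A CONFIGURATION: for the design `h 0 = 0`, `h 1 S = (B S, (B S)²)`, the point of `f` read through
`V` is `(B S, (B S)²)` with `S = V ∩ f⁻¹ 1`. [folklore] -/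
theorem sum_design (h : Fin 2 → Finset (Fin x) → (Fin 2 →₀ ℕ)) (h0 : ∀ S, h 0 S = 0)
    (h1 : ∀ S, h 1 S = Finsupp.single 0 (B S) + Finsupp.single 1 (B S ^ 2))
    (V : Finset (Fin x)) (f : Fin x → Fin 2) :
    ∑ d, h d (V ∩ univ.filter fun u => f u = d) =
      Finsupp.single 0 (B (V ∩ univ.filter fun u => f u = 1)) +
        Finsupp.single 1 (B (V ∩ univ.filter fun u => f u = 1) ^ 2) := by
  rw [Fin.sum_univ_two, h0, h1, zero_add]

/-- THE INDICATOR COLOURING: for `S ⊆ V`, the `V`-relative `1`-fibre of the indicator colouring of `S` is `S`.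
[folklore] -/
theorem fibre_indicator (V S : Finset (Fin x)) (hS : S ⊆ V) :
    (V ∩ univ.filter fun u => (if u ∈ S then (1 : Fin 2) else 0) = 1) = S := by
  ext u
  simp only [Finset.mem_inter, Finset.mem_filter, Finset.mem_univ, true_and]
  constructor
  · rintro ⟨-, hu⟩
    by_contra hu'
    rw [if_neg hu'] at hu
    exact absurd hu (by decide)
  · intro hu
    exact ⟨hS hu, by rw [if_pos hu]⟩

/-- THE CLOUD IS THE SET OF PARABOLA POINTS OVER `𝒫(V)`: `p` is a point of the design read through `V` iff
`p = (B S, (B S)²)` for some `S ⊆ V`. [folklore] -/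
theorem mem_cloud_iff (h : Fin 2 → Finset (Fin x) → (Fin 2 →₀ ℕ)) (h0 : ∀ S, h 0 S = 0)
    (h1 : ∀ S, h 1 S = Finsupp.single 0 (B S) + Finsupp.single 1 (B S ^ 2))
    (V : Finset (Fin x)) (p : Fin 2 →₀ ℕ) :
    p ∈ (univ.image fun f : Fin x → Fin 2 => ∑ d, h d (V ∩ univ.filter fun u => f u = d)) ↔
      ∃ S ⊆ V, Finsupp.single 0 (B S) + Finsupp.single 1 (B S ^ 2) = p := by
  simp only [Finset.mem_image, Finset.mem_univ, true_and, sum_design B h h0 h1]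
  constructor
  · rintro ⟨f, rfl⟩
    exact ⟨_, Finset.inter_subset_left, rfl⟩
  · rintro ⟨S, hS, rfl⟩
    exact ⟨fun u => if u ∈ S then 1 else 0, by rw [fibre_indicator V S hS]⟩

/-- THE COUNT, for an abstract cloud: if `B` is injective and the finite set `C` consists exactly of the parabola
points `(B S, (B S)²)`, `S ⊆ V`, then at least `2^{|V|}` points of `C` are strict maximisers over `C` of a height
`t·q₀ − q₁` (namely all of them, `(B S, (B S)²)` for `t = 2·B S`). [folklore] -/
theorem count_of_cloud (hB : Function.Injective B) (V : Finset (Fin x)) (C : Finset (Fin 2 →₀ ℕ))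
    (hmem : ∀ p, p ∈ C ↔ ∃ S ⊆ V, Finsupp.single 0 (B S) + Finsupp.single 1 (B S ^ 2) = p) :
    2 ^ V.card ≤ {p : Fin 2 →₀ ℕ | p ∈ C ∧ ∃ t : ℝ, ∀ q ∈ C, q ≠ p →
      t * ((q 0 : ℕ) : ℝ) + (-1) * ((q 1 : ℕ) : ℝ) < t * ((p 0 : ℕ) : ℝ) + (-1) * ((p 1 : ℕ) : ℝ)}.ncard := by
  -- `S ↦ (B S, (B S)²)` is injective (first coordinate)
  have hinj : Function.Injective fun S : Finset (Fin x) =>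
      (Finsupp.single 0 (B S) + Finsupp.single 1 (B S ^ 2) : Fin 2 →₀ ℕ) := fun S S' hSS' =>
    hB (by simpa using congrArg (fun q : Fin 2 →₀ ℕ => q 0) hSS')
  calc 2 ^ V.card
      = (V.powerset.image fun S =>
          (Finsupp.single 0 (B S) + Finsupp.single 1 (B S ^ 2) : Fin 2 →₀ ℕ)).card := by
        rw [Finset.card_image_of_injective _ hinj, Finset.card_powerset]
    _ = (↑(V.powerset.image fun S =>
          (Finsupp.single 0 (B S) + Finsupp.single 1 (B S ^ 2) : Fin 2 →₀ ℕ)) : Set (Fin 2 →₀ ℕ)).ncard :=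
        (Set.ncard_coe_finset _).symm
    _ ≤ _ := by
        refine Set.ncard_le_ncard (fun p hp => ?_) (C.finite_toSet.subset fun p hp => hp.1)
        obtain ⟨S, hS, rfl⟩ := Finset.mem_image.mp (Finset.mem_coe.mp hp)
        refine ⟨(hmem _).mpr ⟨S, Finset.mem_powerset.mp hS, rfl⟩, 2 * (B S : ℝ), fun q hq hne => ?_⟩
        -- any other cloud point is a parabola point with a different abscissa
        obtain ⟨S', -, rfl⟩ := (hmem q).mp hq
        have hb : B S' ≠ B S := fun hb => hne (by rw [hb])
        rw [(point_apply _ _).1, (point_apply _ _).2, (point_apply _ _).1, (point_apply _ _).2]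
        exact tangent_exposed (B S) (B S') hb

/-- THE COUNT for the parabola design `h 0 = 0`, `h 1 S = (B S, (B S)²)` with `B` injective: read through any
`V ⊆ Fin x`, at least `2^{|V|}` cloud points are lower-hull vertices. [folklore] -/
theorem twoCore_count (hB : Function.Injective B) (h : Fin 2 → Finset (Fin x) → (Fin 2 →₀ ℕ))
    (h0 : ∀ S, h 0 S = 0) (h1 : ∀ S, h 1 S = Finsupp.single 0 (B S) + Finsupp.single 1 (B S ^ 2))
    (V : Finset (Fin x)) :
    2 ^ V.card ≤
      {p : Fin 2 →₀ ℕ | p ∈ (Finset.univ.image fun f : Fin x → Fin 2 =>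
            ∑ d, h d (V ∩ Finset.univ.filter fun u => f u = d)) ∧
          ∃ t : ℝ, ∀ q ∈ (Finset.univ.image fun f : Fin x → Fin 2 =>
            ∑ d, h d (V ∩ Finset.univ.filter fun u => f u = d)), q ≠ p →
            t * ((q 0 : ℕ) : ℝ) + (-1) * ((q 1 : ℕ) : ℝ) < t * ((p 0 : ℕ) : ℝ) + (-1) * ((p 1 : ℕ) : ℝ)}.ncard :=
  count_of_cloud B hB V _ (mem_cloud_iff B h h0 h1 V)

end Design

end TwoCorePerfectAux

/-- STUB P15 — **two cores are hereditarily perfect.**  There is a two-core design `h` such that, read through EVERY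
window `V ⊆ Fin x`, the cloud of configuration points `Σ_d h d (V ∩ f⁻¹ d)`, `f : Fin x → Fin 2`, has at least
`2^{|V|}` lower-hull vertices (strict maximisers over the cloud of a height `t·q₀ − q₁`, `t ∈ ℝ`), matching the upper
bound of P12 (`stub_twoCoreChartRel`).  Construction: `h 0 = 0`, `h 1 S = (B S, (B S)²)` with the injective base-`3`
weight `B S = Σ_{u ∈ S} 3^u`; the cloud through `V` is the set of `2^{|V|}` parabola points `(B S, (B S)²)`, `S ⊆ V`,
each strictly exposed by the tangent height `t = 2·B S`. [folklore] -/
theorem stub_twoCorePerfect (x : ℕ) :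
    ∃ h : Fin 2 → Finset (Fin x) → (Fin 2 →₀ ℕ), ∀ V : Finset (Fin x),
      2 ^ V.card ≤
        {p : Fin 2 →₀ ℕ | p ∈ (Finset.univ.image fun f : Fin x → Fin 2 =>
              ∑ d, h d (V ∩ Finset.univ.filter fun u => f u = d)) ∧
            ∃ t : ℝ, ∀ q ∈ (Finset.univ.image fun f : Fin x → Fin 2 =>
              ∑ d, h d (V ∩ Finset.univ.filter fun u => f u = d)), q ≠ p →
              t * ((q 0 : ℕ) : ℝ) + (-1) * ((q 1 : ℕ) : ℝ) < t * ((p 0 : ℕ) : ℝ) + (-1) * ((p 1 : ℕ) : ℝ)}.ncard := by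
  -- the parabola design `h 1 S = (B S, (B S)²)`, `h 0 S = 0` for the base-`3` weight `B S = Σ_{u ∈ S} 3^u`
  -- (the design is spelled out twice: as the witness and as the explicit argument of the count)
  exact ⟨fun d S => if d = 1 then
      Finsupp.single 0 (∑ u ∈ S, 3 ^ (u : ℕ)) + Finsupp.single 1 ((∑ u ∈ S, 3 ^ (u : ℕ)) ^ 2) else 0,
    TwoCorePerfectAux.twoCore_count (fun S : Finset (Fin x) => ∑ u ∈ S, 3 ^ (u : ℕ))
      (TwoCorePerfectAux.weight_injective x)
      (fun d S => if d = 1 then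
        Finsupp.single 0 (∑ u ∈ S, 3 ^ (u : ℕ)) + Finsupp.single 1 ((∑ u ∈ S, 3 ^ (u : ℕ)) ^ 2) else 0)
      (fun _ => if_neg (by decide)) (fun _ => if_pos rfl)⟩

end Summit.ValiantsHypothesis.ValiantsHypothesis.Theorems.NewtonUnitEquationsNewtonTauWeak
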